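import Mathlib
import HarnessLib
import Summits.MatrixMultiplication.MatrixMultiplication.Theorems.OutsiderSandwichToricCeilingPowMixedGlue
import Summits.MatrixMultiplication.MatrixMultiplication.Theorems.OutsiderSandwichToricCeilingPowMixedRules

/-!
# OutsiderSandwich — toric ceiling of `cw₂^{⊠N}`: the `N = 3` TWO-CW BASE CENSUS, definitions
(frame `cw ⊠ cw ⊠ D`; checker, symmetry group, instance enumeration)
(decomp-mm lens 4, gen 47, kernel K47-6a; THESES-FREE, `ω`-free; helper toward `LaserTangency`,
stmt-32268 — the extremal subrank/packing cells of the literal host `kroneckerPow (cwTensor ℂ 2) N`)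

LABEL.  TORIC · FINITE (`N = 3`) · NEC-side instrument.  This file and its companions
`…TwoCwBaseDataA–D` (certificates), `…TwoCwBaseCensusA–D` (kernel-`decide`d checks) and
`…TwoCwBase` (bridge and assembly) discharge the base hypothesis `hB₃'` of
`…PowTwoCw.productFrame_atMostTwoCw_no_diagonal_comb_degeneration_sub_two`: every LAWFUL co-size-2
complement of a two-cw product frame over `Word 3` has a perfect matching.  The rates, the crux
`h₁ = LaserTangency` and the route's `closes` are untouched.

WHAT (this file; everything Boolean / computable, no proofs beyond `decide`).  Words of length `3`
are CODED as letter triples (`W₃`, `enc`/`dec`); the basis is fixed to `κ₀ = (cw, cw, D)` (the other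
two arrangements follow by permuting coordinates, `…PowTransport.exists_isPMκ_perm`).
`valid X Y Z M` CHECKS that a list of 25 coded rows is a perfect matching of `frame κ₀` minus the
coded pairs; `decodePM`/`goodD` read a matching off a numeric certificate (base `729`).  The symmetry
group (48 elements, `G₃`/`actW`): at each cw coordinate the letter maps `{id, (1 2)}` (`Lmap`), at the
`D` coordinate the six affine maps of `𝔽₃` (`Dmap`), and the exchange of the two cw coordinates; all
preserve the slots and the letter law (`slot_*`, `law_*`, by `decide`).  `canonX` lists the 19 orbit
representatives of pairs of distinct codes (ORBIT LEMMA `exists_canon` from the kernel-decided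
cover `canonB`), split into twelve groups `cX0 … cX11` (`canonX_eq`) for the data files;
`instOf Xs` ENUMERATES, for the `x`-pairs in `Xs`, all coordinatewise-lawful completions `(Y, Z)`
(`compl`, from `…PowMixedRules.lawκ`) with increasing pairs and `Y ≤ Z` (`admissible`);
`check Xs ds` is the census predicate.  DATA: `exp/base3.py` (lens 4, g47) regenerates groups,
instances (3 510 in all) and certificates.  No new axioms.
-/

set_option linter.dupNamespace false
set_option maxRecDepth 200000

namespace Summit.MatrixMultiplication.MatrixMultiplication.Theorems.OutsiderSandwichToricCeilingPowTwoCwBaseDefs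

open Finset
open Summit.MatrixMultiplication.MatrixMultiplication.Theorems.OutsiderSandwichToricCeilingPowFibres
  (Word Tr3 slotB frame)
open Summit.MatrixMultiplication.MatrixMultiplication.Theorems.OutsiderSandwichToricCeilingPowMixedGlue
open Summit.MatrixMultiplication.MatrixMultiplication.Theorems.OutsiderSandwichToricCeilingPowMixedRules

/-! ## §1 Codes (words of length 3 as letter triples) -/

/-- A coded word of length `3`. [new] -/
abbrev W₃ := Fin 3 × Fin 3 × Fin 3

/-- A coded row. [new] -/
abbrev T₃ := W₃ × W₃ × W₃

/-- A coded co-size-2 instance: the three removed pairs. [new] -/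
abbrev I₃ := (W₃ × W₃) × (W₃ × W₃) × (W₃ × W₃)

/-- Code of a word. [new] -/
def enc (w : Word 3) : W₃ := (w 0, w 1, w 2)

/-- Word of a code. [new] -/
def dec (u : W₃) : Word 3 := ![u.1, u.2.1, u.2.2]

/-- `dec` undoes `enc`. -/
@[simp] theorem dec_enc (w : Word 3) : dec (enc w) = w := by
  ext i; fin_cases i <;> rfl

/-- `enc` undoes `dec`. -/
@[simp] theorem enc_dec (u : W₃) : enc (dec u) = u := rfl

/-- `dec` is injective. -/
theorem dec_injective : Function.Injective dec :=
  fun u v h => by rw [← enc_dec u, ← enc_dec v, h]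

/-- Decode a coded row. [new] -/
def dec3 (t : T₃) : Tr3 3 := (dec t.1, dec t.2.1, dec t.2.2)

/-- The basis `cw ⊠ cw ⊠ D`. [new] -/
def κ₀ : Fin 3 → Bool := ![true, true, false]

/-! ## §2 The checker (Boolean, run by `decide`) -/

/-- All 27 codes, in increasing order of `wcode`. [new] -/
def allW : List W₃ :=
  [0, 1, 2].flatMap fun a => [0, 1, 2].flatMap fun b => [0, 1, 2].map fun c => (a, b, c)

/-- `allW` is exhaustive. -/
theorem mem_allW : ∀ u : W₃, u ∈ allW := by decide

/-- Numeric code `9a + 3b + c`. [new] -/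
def wcode (u : W₃) : ℕ := 9 * u.1.val + 3 * u.2.1.val + u.2.2.val

/-- Strict order of codes. [new] -/
def ltW (u v : W₃) : Bool := decide (wcode u < wcode v)

/-- Weak lexicographic order of coded pairs. [new] -/
def leP (Y Z : W₃ × W₃) : Bool :=
  decide (wcode Y.1 < wcode Z.1 ∨ (wcode Y.1 = wcode Z.1 ∧ wcode Y.2 ≤ wcode Z.2))

/-- A coded row lies in the frame `cw ⊠ cw ⊠ D`. [new] -/
def rowOK (t : T₃) : Bool :=
  slotB true t.1.1 t.2.1.1 t.2.2.1 && slotB true t.1.2.1 t.2.1.2.1 t.2.2.2.1 &&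
    slotB false t.1.2.2 t.2.1.2.2 t.2.2.2.2

/-- CHECKER: `M` is a perfect matching of `cw ⊠ cw ⊠ D` minus the coded pairs `X, Y, Z` — 25 frame
rows avoiding the removed codes, with pairwise distinct legs. [new] -/
def valid (X Y Z : W₃ × W₃) (M : List T₃) : Bool :=
  (M.all fun t => rowOK t && decide (t.1 ≠ X.1 ∧ t.1 ≠ X.2 ∧ t.2.1 ≠ Y.1 ∧ t.2.1 ≠ Y.2 ∧
    t.2.2 ≠ Z.1 ∧ t.2.2 ≠ Z.2)) &&
  decide ((M.map fun t => t.1).Nodup ∧ (M.map fun t => t.2.1).Nodup ∧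
    (M.map fun t => t.2.2).Nodup ∧ M.length = 25)

/-- The code with numeric code `n % 27`. [new] -/
def ofCode (n : ℕ) : W₃ := (Fin.ofNat 3 (n / 9), Fin.ofNat 3 (n / 3), Fin.ofNat 3 n)

/-- The `x`-vertices of an instance: all codes but the removed pair, increasing. [new] -/
def verts (X : W₃ × W₃) : List W₃ := allW.filter fun w => decide (w ≠ X.1 ∧ w ≠ X.2)

/-- Decode a matching from its numeric certificate: base-`729` digits `27·code(y) + code(z)` along
the increasing `x`-vertices. [new] -/
def decodePM : List W₃ → ℕ → List T₃
  | [], _ => []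
  | x :: xs, n => (x, ofCode (n % 729 / 27), ofCode (n % 27)) :: decodePM xs (n / 729)

/-- The certificate `n` decodes to a valid matching of the instance `I`. [new] -/
def goodD (I : I₃) (n : ℕ) : Bool := valid I.1 I.2.1 I.2.2 (decodePM (verts I.1) n)

/-! ## §3 The symmetry group of `cw ⊠ cw ⊠ D` (order 48) and the canonical `x`-pairs -/

/-- Letter maps at a cw coordinate: the identity and the transposition `(1 2)`. [new] -/
def Lmap (k : Fin 2) (a : Fin 3) : Fin 3 := if k = 0 then a else ![0, 2, 1] a

/-- `Lmap k` is an involution. -/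
theorem Lmap_invol : ∀ k a, Lmap k (Lmap k a) = a := by decide

/-- `Lmap k` as a permutation of the letters. [new] -/
def Lperm (k : Fin 2) : Equiv.Perm (Fin 3) := ⟨Lmap k, Lmap k, Lmap_invol k, Lmap_invol k⟩

/-- Letter maps at the permutation coordinate: the six affine maps `a ↦ ua + v` of `𝔽₃`. [new] -/
def Dmap (k : Fin 6) (a : Fin 3) : Fin 3 := ![a, a + 1, a + 2, 2 * a, 2 * a + 1, 2 * a + 2] k

/-- Their inverses. [new] -/
def Dinv (k : Fin 6) (a : Fin 3) : Fin 3 := ![a, a + 2, a + 1, 2 * a, 2 * a + 1, 2 * a + 2] k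

/-- `Dinv k` is a left inverse of `Dmap k`. -/
theorem Dinv_Dmap : ∀ k a, Dinv k (Dmap k a) = a := by decide

/-- `Dinv k` is a right inverse of `Dmap k`. -/
theorem Dmap_Dinv : ∀ k a, Dmap k (Dinv k a) = a := by decide

/-- `Dmap k` as a permutation of the letters. [new] -/
def Dperm (k : Fin 6) : Equiv.Perm (Fin 3) := ⟨Dmap k, Dinv k, Dinv_Dmap k, Dmap_Dinv k⟩

/-- `Lmap k` preserves the cw slot. -/
theorem slot_Lmap : ∀ k (a b c : Fin 3), slotB true a b c = true →
    slotB true (Lmap k a) (Lmap k b) (Lmap k c) = true := by decide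

/-- `Dmap k` preserves the permutation slot. -/
theorem slot_Dmap : ∀ k (a b c : Fin 3), slotB false a b c = true →
    slotB false (Dmap k a) (Dmap k b) (Dmap k c) = true := by decide

/-- `Dinv k` preserves the permutation slot. -/
theorem slot_Dinv : ∀ k (a b c : Fin 3), slotB false a b c = true →
    slotB false (Dinv k a) (Dinv k b) (Dinv k c) = true := by decide

/-- `Lmap k` preserves the cw letter law. -/
theorem law_Lmap : ∀ k (a b c d e f : Fin 3), lawκ true (Lmap k a) (Lmap k b) (Lmap k c) (Lmap k d)
    (Lmap k e) (Lmap k f) = lawκ true a b c d e f := by decide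

/-- `Dmap k` preserves the permutation letter law. -/
theorem law_Dmap : ∀ k (a b c d e f : Fin 3), lawκ false (Dmap k a) (Dmap k b) (Dmap k c)
    (Dmap k d) (Dmap k e) (Dmap k f) = lawκ false a b c d e f := by decide

/-- Index set of the symmetry group: letter maps at the three coordinates and an optional exchange
of the two cw coordinates (48 elements). [new] -/
abbrev G₃ := Fin 2 × Fin 2 × Fin 6 × Bool

/-- The action on codes (letter maps first, then the optional coordinate exchange). [new] -/
def actW (g : G₃) (u : W₃) : W₃ :=
  if g.2.2.2 then (Lmap g.2.1 u.2.1, Lmap g.1 u.1, Dmap g.2.2.1 u.2.2)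
  else (Lmap g.1 u.1, Lmap g.2.1 u.2.1, Dmap g.2.2.1 u.2.2)

/-- All group indices. [new] -/
def allG : List G₃ :=
  [0, 1].flatMap fun k₀ => [0, 1].flatMap fun k₁ => [0, 1, 2, 3, 4, 5].flatMap fun k =>
    [false, true].map fun s => (k₀, k₁, k, s)

/-- Increasingly ordered version of a pair of codes. [new] -/
def sortP (u v : W₃) : W₃ × W₃ := if ltW u v then (u, v) else (v, u)

/-- Canonical `x`-pairs, group 0. [new] -/
def cX0 : List (W₃ × W₃) := [((0, 0, 0), (0, 0, 1)), ((0, 0, 0), (0, 1, 0)), ((0, 0, 0), (0, 1, 1))]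

/-- Canonical `x`-pairs, group 1. [new] -/
def cX1 : List (W₃ × W₃) := [((0, 0, 0), (1, 1, 0))]

/-- Canonical `x`-pairs, group 2. [new] -/
def cX2 : List (W₃ × W₃) := [((0, 0, 0), (1, 1, 1))]

/-- Canonical `x`-pairs, group 3. [new] -/
def cX3 : List (W₃ × W₃) := [((0, 1, 0), (0, 1, 1)), ((0, 1, 0), (0, 2, 0)), ((0, 1, 0), (0, 2, 1))]

/-- Canonical `x`-pairs, group 4. [new] -/
def cX4 : List (W₃ × W₃) := [((0, 1, 0), (1, 0, 0))]

/-- Canonical `x`-pairs, group 5. [new] -/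
def cX5 : List (W₃ × W₃) := [((0, 1, 0), (1, 0, 1))]

/-- Canonical `x`-pairs, group 6. [new] -/
def cX6 : List (W₃ × W₃) := [((0, 1, 0), (1, 1, 0))]

/-- Canonical `x`-pairs, group 7. [new] -/
def cX7 : List (W₃ × W₃) := [((0, 1, 0), (1, 1, 1)), ((0, 1, 0), (1, 2, 0))]

/-- Canonical `x`-pairs, group 8. [new] -/
def cX8 : List (W₃ × W₃) := [((0, 1, 0), (1, 2, 1))]

/-- Canonical `x`-pairs, group 9. [new] -/
def cX9 : List (W₃ × W₃) := [((1, 1, 0), (1, 1, 1)), ((1, 1, 0), (1, 2, 0))]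

/-- Canonical `x`-pairs, group 10. [new] -/
def cX10 : List (W₃ × W₃) := [((1, 1, 0), (1, 2, 1)), ((1, 1, 0), (2, 2, 0))]

/-- Canonical `x`-pairs, group 11. [new] -/
def cX11 : List (W₃ × W₃) := [((1, 1, 0), (2, 2, 1))]

/-- The 19 canonical `x`-pairs: orbit representatives (code-order minima) of the pairs of distinct
codes under the 48-element group; `= cX0 ++ ⋯ ++ cX11` (`canonX_eq`). [new] -/
def canonX : List (W₃ × W₃) := [
  ((0, 0, 0), (0, 0, 1)),
  ((0, 0, 0), (0, 1, 0)),
  ((0, 0, 0), (0, 1, 1)),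
  ((0, 0, 0), (1, 1, 0)),
  ((0, 0, 0), (1, 1, 1)),
  ((0, 1, 0), (0, 1, 1)),
  ((0, 1, 0), (0, 2, 0)),
  ((0, 1, 0), (0, 2, 1)),
  ((0, 1, 0), (1, 0, 0)),
  ((0, 1, 0), (1, 0, 1)),
  ((0, 1, 0), (1, 1, 0)),
  ((0, 1, 0), (1, 1, 1)),
  ((0, 1, 0), (1, 2, 0)),
  ((0, 1, 0), (1, 2, 1)),
  ((1, 1, 0), (1, 1, 1)),
  ((1, 1, 0), (1, 2, 0)),
  ((1, 1, 0), (1, 2, 1)),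
  ((1, 1, 0), (2, 2, 0)),
  ((1, 1, 0), (2, 2, 1))]

/-- Every canonical pair is increasingly ordered. -/
theorem canonX_lt : ∀ X ∈ canonX, ltW X.1 X.2 = true := by decide +kernel

/-- The canonical pairs are the concatenation of the twelve groups. -/
theorem canonX_eq : canonX = cX0 ++ (cX1 ++ (cX2 ++ (cX3 ++ (cX4 ++ (cX5 ++ (cX6 ++ (cX7 ++ (cX8 ++ (cX9 ++ (cX10 ++ cX11)))))))))) := by
  decide +kernel

set_option maxHeartbeats 4000000 in
/-- ORBIT COVER (kernel-decided): every pair of distinct codes is carried into `canonX` by some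
group element. -/
theorem canonB : (allW.all fun u => allW.all fun v => decide (u = v) ||
    allG.any fun g => decide (sortP (actW g u) (actW g v) ∈ canonX)) = true := by
  decide +kernel

/-- ORBIT LEMMA. -/
theorem exists_canon (u v : W₃) (h : u ≠ v) : ∃ g : G₃, sortP (actW g u) (actW g v) ∈ canonX := by
  have hc := canonB
  simp only [List.all_eq_true, Bool.or_eq_true, decide_eq_true_eq, List.any_eq_true] at hc
  rcases hc u (mem_allW u) v (mem_allW v) with e | ⟨g, -, hg⟩
  · exact absurd e h
  · exact ⟨g, hg⟩

/-! ## §4 Instance enumeration and the census predicate -/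

/-- All letter quadruples, lexicographically. [new] -/
def allQ : List (Fin 3 × Fin 3 × Fin 3 × Fin 3) :=
  [0, 1, 2].flatMap fun c => [0, 1, 2].flatMap fun d => [0, 1, 2].flatMap fun e =>
    [0, 1, 2].map fun f => (c, d, e, f)

/-- `allQ` is exhaustive. -/
theorem mem_allQ : ∀ q : Fin 3 × Fin 3 × Fin 3 × Fin 3, q ∈ allQ := by decide

/-- Lawful completions `(y₁ᵢ, y₂ᵢ, z₁ᵢ, z₂ᵢ)` of the letters `(x₁ᵢ, x₂ᵢ) = (a, b)` at a coordinate
of kind `q` (`…PowMixedRules.lawκ`). [new] -/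
def compl (q : Bool) (a b : Fin 3) : List (Fin 3 × Fin 3 × Fin 3 × Fin 3) :=
  allQ.filter fun r => lawκ q a b r.1 r.2.1 r.2.2.1 r.2.2.2

/-- Assemble a coded instance from the `x`-pair and the three coordinate completions. [new] -/
def mkI (X : W₃ × W₃) (q₀ q₁ q₂ : Fin 3 × Fin 3 × Fin 3 × Fin 3) : I₃ :=
  (X, ((q₀.1, q₁.1, q₂.1), (q₀.2.1, q₁.2.1, q₂.2.1)),
    ((q₀.2.2.1, q₁.2.2.1, q₂.2.2.1), (q₀.2.2.2, q₁.2.2.2, q₂.2.2.2)))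

/-- Orientation filter: `y`- and `z`-pairs increasing, `y`-pair before `z`-pair. [new] -/
def admissible (I : I₃) : Bool := ltW I.2.1.1 I.2.1.2 && ltW I.2.2.1 I.2.2.2 && leP I.2.1 I.2.2

/-- THE INSTANCES of the `x`-pairs `Xs`: coordinatewise-lawful completions, admissible
orientation. [new] -/
def instOf (Xs : List (W₃ × W₃)) : List I₃ :=
  Xs.flatMap fun X => (compl true X.1.1 X.2.1).flatMap fun q₀ =>
    (compl true X.1.2.1 X.2.2.1).flatMap fun q₁ =>
      (compl false X.1.2.2 X.2.2.2).filterMap fun q₂ =>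
        if admissible (mkI X q₀ q₁ q₂) then some (mkI X q₀ q₁ q₂) else none

/-- THE CENSUS PREDICATE for a group of `x`-pairs and its certificate list: equal lengths and every
certificate decodes to a valid matching of its instance. [new] -/
def check (Xs : List (W₃ × W₃)) (ds : List ℕ) : Bool :=
  decide ((instOf Xs).length = ds.length) && ((instOf Xs).zip ds).all fun p => goodD p.1 p.2

end Summit.MatrixMultiplication.MatrixMultiplication.Theorems.OutsiderSandwichToricCeilingPowTwoCwBaseDefs
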